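import Summits.AnomalousDissipation.AnomalousDissipation.Theorems.SolenoidalFractalHomogenisationLagrangianStepFrameDistortion
import HarnessLib

/-!
# K1L_D (stmt-AnomalousDissipation-27980), sub-stub S1′ `stub_conjugateL` (b): identification of the RESIDUAL CARRIER in the frame
# (helper; `--supports … --as helper`)

Cheap glue around the frame definitions `…LagrangianStepFrameDefs` (p647381): the Jacobian matrix `frameJac` represents the operator
`flowDeriv` (`frameJac *ᵥ v = flowDeriv v` in coordinates), it is invertible when entrywise close to the identity, and the pulled-back residual
carrier of S1′(b) is `0` when no level is left (`m′ = m`) and is EXACTLY the Eulerian lattice level `level (m+1)` when one level is left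
(`m′ = m+1`, by `IsInserted`: `b (m+1) t (X y) = flowDeriv (level (m+1) t y)` and `frameG · frameJac = 1`).  Lead-k1l-onelevel-p1 g2, sub-split
`Cruxes/LagrangianRenormalisationStep/Lines/onelevel_S23_split.lean`.  Infrastructure for rung F-D1.A0; NOT a proof of the crux or of anomalous dissipation.
-/

set_option linter.dupNamespace false

namespace Summit.AnomalousDissipation.AnomalousDissipation.Theorems.SolenoidalFractalHomogenisation.LagrangianStep

open Set Function
open scoped NNReal
open Literature.Analysis Literature.Analysis.FunctionSpaces Literature.Analysis.FunctionSpaces.Torus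
open Literature.Analysis.FluidPDE Literature.Analysis.FluidPDE.LatticeShear

noncomputable section

variable {k : ℕ}

/-- The Jacobian matrix represents the flow derivative: `(frameJac E m t w y) *ᵥ v = flowDeriv m t w y v` in coordinates. -/
theorem frameJac_mulVec (E : LagrangianLatticeCarrier k) (m : ℕ) (t w : ℝ) (y : UnitAddTorus (Fin 3))
    (v : EuclideanSpace ℝ (Fin 3)) (a : Fin 3) :
    (frameJac E m t w y).mulVec (WithLp.ofLp v) a = (E.flowDeriv m t w y v) a := by
  have hv : v = ∑ c, v c • EuclideanSpace.single c (1:ℝ) := by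
    ext i
    simp only [WithLp.ofLp_sum, WithLp.ofLp_smul, Finset.sum_apply, Pi.smul_apply, smul_eq_mul,
      PiLp.ofLp_single]
    rw [Finset.sum_eq_single i (fun b _ hb => by simp [Ne.symm hb]) (by simp)]
    simp
  conv_rhs => rw [hv]
  simp only [map_sum, map_smul, Matrix.mulVec, dotProduct, frameJac, Matrix.of_apply]
  rw [WithLp.ofLp_sum]
  simp only [WithLp.ofLp_smul, Finset.sum_apply, Pi.smul_apply, smul_eq_mul]
  refine Finset.sum_congr rfl fun c _ => ?_
  ring

/-- `distort` by the Jacobian matrix is the flow derivative as a field operation. -/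
theorem distort_frameJac (E : LagrangianLatticeCarrier k) (m : ℕ) (t w : ℝ) (v : UnitAddTorus (Fin 3) → EuclideanSpace ℝ (Fin 3)) :
    Torus.distort (frameJac E m t w) v = fun y => E.flowDeriv m t w y (v y) := by
  funext y
  ext a
  rw [Torus.distort_apply]
  have := frameJac_mulVec E m t w y (v y) a
  simpa [Matrix.mulVec, dotProduct] using this

/-- An entrywise near-identity Jacobian is invertible: if `|frameJac − 1| ≤ ε` entrywise with `3ε < 1` then `frameJac` is a unit. -/
theorem isUnit_frameJac_of_entry_le (E : LagrangianLatticeCarrier k) (m : ℕ) (t w : ℝ) (y : UnitAddTorus (Fin 3)) {ε : ℝ}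
    (h : ∀ a c, |frameJac E m t w y a c - (1 : Matrix (Fin 3) (Fin 3) ℝ) a c| ≤ ε) (hε : 3 * ε < 1) :
    IsUnit (frameJac E m t w y) := by
  letI : NormedRing (Matrix (Fin 3) (Fin 3) ℝ) := Matrix.linftyOpNormedRing
  letI : NormedAlgebra ℝ (Matrix (Fin 3) (Fin 3) ℝ) := Matrix.linftyOpNormedAlgebra
  haveI : CompleteSpace (Matrix (Fin 3) (Fin 3) ℝ) := FiniteDimensional.complete ℝ _
  have hε0 : 0 ≤ ε := (abs_nonneg _).trans (h 0 0)
  set T : Matrix (Fin 3) (Fin 3) ℝ := 1 - frameJac E m t w y with hT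
  have hTn : ‖T‖ ≤ 3 * ε := by
    rw [Matrix.linfty_opNorm_def]
    have key : ∀ i, (∑ j, ‖T i j‖₊ : NNReal) ≤ Real.toNNReal (3 * ε) := by
      intro i
      rw [← NNReal.coe_le_coe, NNReal.coe_sum, Real.coe_toNNReal _ (by positivity)]
      calc ∑ j, ((‖T i j‖₊ : NNReal) : ℝ) = ∑ j, |T i j| := by simp only [coe_nnnorm, Real.norm_eq_abs]
        _ ≤ ∑ _j : Fin 3, ε := Finset.sum_le_sum fun j _ => by
            rw [hT, Matrix.sub_apply, abs_sub_comm]; exact h i j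
        _ = 3 * ε := by simp
    have hsup : ((Finset.univ : Finset (Fin 3)).sup fun i => ∑ j, ‖T i j‖₊) ≤ Real.toNNReal (3 * ε) :=
      Finset.sup_le fun i _ => key i
    calc (((Finset.univ : Finset (Fin 3)).sup fun i => ∑ j, ‖T i j‖₊ : NNReal) : ℝ)
        ≤ (Real.toNNReal (3 * ε) : ℝ) := by exact_mod_cast hsup
      _ = 3 * ε := Real.coe_toNNReal _ (by positivity)
  have hT1 : ‖T‖ < 1 := hTn.trans_lt hε
  have hU : IsUnit (1 - T) := isUnit_one_sub_of_norm_lt_one hT1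
  have : (1 : Matrix (Fin 3) (Fin 3) ℝ) - T = frameJac E m t w y := by rw [hT]; abel
  rwa [this] at hU

/-- `frameG · frameJac = 1` for an invertible Jacobian: the distortion field undoes the flow derivative,
`distort frameG (flowDeriv v) = v`. -/
theorem distort_frameG_flowDeriv (E : LagrangianLatticeCarrier k) (m : ℕ) (t w : ℝ)
    (hU : ∀ y, IsUnit (frameJac E m t w y)) (v : UnitAddTorus (Fin 3) → EuclideanSpace ℝ (Fin 3)) :
    Torus.distort (frameG E m t w) (fun y => E.flowDeriv m t w y (v y)) = v := by
  rw [← distort_frameJac]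
  funext y
  ext a
  rw [Torus.distort_apply]
  have hdet : IsUnit (frameJac E m t w y).det := (Matrix.isUnit_iff_isUnit_det _).mp (hU y)
  have h1 : (frameG E m t w y).mulVec ((frameJac E m t w y).mulVec (WithLp.ofLp (v y))) = WithLp.ofLp (v y) := by
    rw [Matrix.mulVec_mulVec, frameG, Matrix.nonsing_inv_mul _ hdet, Matrix.one_mulVec]
  have h2 := congrFun h1 a
  simp only [Matrix.mulVec, dotProduct] at h2
  have h3 : ∀ c, Torus.distort (frameJac E m t w) v y c = ∑ x, frameJac E m t w y c x * (WithLp.ofLp (v y)) x := fun c => by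
    rw [Torus.distort_apply]
  simp_rw [h3]
  exact h2

/-- **No residual level (`m′ = m`): the pulled-back residual carrier vanishes.** -/
theorem residualCarrier_self (E : LagrangianLatticeCarrier k) (m : ℕ) (w : ℝ) :
    residualCarrier E m m w = fun _ _ => 0 := by
  funext s y
  ext a
  simp [residualCarrier, Torus.distort_apply]

/-- **One residual level (`m′ = m+1`): the pulled-back residual carrier IS the Eulerian lattice level.**  On the refresh window `j` of level `m+1`
(left end `w = j·refresh (m+1)`), `IsInserted m` and the invertibility of the frame Jacobian give
`residualCarrier E m (m+1) w s = level (m+1) (w+s)`. -/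
theorem residualCarrier_succ (E : LagrangianLatticeCarrier k) (m : ℕ) (hI : E.IsInserted m) (j : ℤ) {w s : ℝ}
    (hw : w = (j : ℝ) * E.refresh (m + 1)) (hs : w + s ∈ E.window (m + 1) j)
    (hU : ∀ y, IsUnit (frameJac E m (w + s) w y)) :
    residualCarrier E m (m + 1) w s = E.toFractalCarrierData.level (m + 1) (w + s) := by
  have hb : ∀ y, E.partialSum (m + 1) (w + s) (E.X m (w + s) w y) - E.partialSum m (w + s) (E.X m (w + s) w y)
      = E.flowDeriv m (w + s) w y (E.toFractalCarrierData.level (m + 1) (w + s) y) := by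
    intro y
    have hsum : E.partialSum (m + 1) (w + s) (E.X m (w + s) w y) - E.partialSum m (w + s) (E.X m (w + s) w y)
        = E.b (m + 1) (w + s) (E.X m (w + s) w y) := by
      simp [LagrangianLatticeCarrier.partialSum, Finset.sum_range_succ]
    rw [hsum]
    have := hI j (w + s) hs y
    rw [← hw] at this
    exact this
  unfold residualCarrier
  simp_rw [hb]
  exact distort_frameG_flowDeriv E m (w + s) w hU _

end

end Summit.AnomalousDissipation.AnomalousDissipation.Theorems.SolenoidalFractalHomogenisation.LagrangianStep
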